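import Summits.Parity.GeneralizedHardyLittlewood.Theses.FordMaynardNoSieveConst0164
import Literature.NumberTheory.Sieve.FordMaynardTweak
import Literature.NumberTheory.Sieve.FordMaynardConstruction
import Literature.Barriers.Parity.FordMaynardPrimeFreeOfTypeIStarProofs

/-!
# Route `FordMaynardNoSieveConst0164` — crux `PrimeFreeOfWitnessAtEta` (stmt-Parity-19103), closed

Ford–Maynard, *On the theory of prime producing sieves* (arXiv:2407.14368), Theorem 6.3 (b) in exact form at
`P = (γ, 0, ν₀)`: for `0 < γ < 1`, `0 < ν₀ < 1`, a negative Type-I* witness `f ∈ 𝔉*_{ν₀}(γ)` (symmetric, supported on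
`{all ξᵢ ≥ ν₀, Σ ξᵢ = 1}`, `f(1) < -1`, `f(1) ≤ f_k` for `k ≥ 2`) yields, for every `B`, a `(γ, 0, ν₀)`-admissible
prime-free weight sequence of mass `≥ B` (`Literature.Barriers.Parity.FordMaynard.PrimeFreeAdmissible γ 0 ν₀ B`).
Proof (the tree's Theorem 9.1 machine): with `δ := -1 - f(1) > 0`, tweak `f` on the two bad windows
`[γ - ε, γ + ε]` (Type-I* identity) and `[ν₀, ν₀ + ε]` (Type-II edge) by `FordMaynardTweak.tweak`; the tweaked `h` is
symmetric, piecewise Lipschitz, bounded, satisfies the Type-I identity, vanishes beyond `⌊1/ν₀⌋` coordinates and on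
every bad proper subsum, and stays within `δ/2` of `f` at good vectors once `ε ≤ δ / (16 (C+1))` for the explicit
fragmentation constant `C`; hence `h(1) < -1 ≤ h_k` and `FordMaynardConstruction.primeFreeAdmissible_of_vecFn`
produces the sequence.  Candidate term of record: planner p3 evidence `PrimeFreeOfWitnessAtEta_holds.lean`
(pub/parity-ideate/parity-ideate-p3/evidence2/, sha16 75e9fd5e340c3a26; registered same-day variant ed0599d61d0ed6e8),
referee PASS—KERNEL 2026-08-25, refuter re-check rc 0 2026-08-27; landed verbatim (docstrings added) by the
decomp-parity landing hand leafhand-parity-fmcert-1 g0 once the Literature closure was in the farm build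
(BUILT 2026-08-31T07:26Z).  Rung F-P1; no summit motion.  Standard axioms only.
-/

noncomputable section

open Finset
open Literature.NumberTheory.Sieve Literature.NumberTheory.Sieve.FordMaynard Literature.Barriers.Parity

namespace Summit.Parity.GeneralizedHardyLittlewood.Theses.FordMaynardNoSieveConst0164

/-- **`PrimeFreeOfWitnessAtEta` holds** (route `FordMaynardNoSieveConst0164`, crux stmt-Parity-19103; Ford–Maynard
Thm 6.3 (b) at `P = (γ, 0, ν₀)`): `∀ γ ν₀, 0 < γ → γ < 1 → 0 < ν₀ → ν₀ < 1 → TypeIStarNegWitness ν₀ γ →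
∀ B, PrimeFreeAdmissible γ 0 ν₀ B` — tweak the witness on the windows `[γ-ε, γ+ε]`, `[ν₀, ν₀+ε]` and feed the
tweaked function to `primeFreeAdmissible_of_vecFn` (Thm 9.1 construction). -/
theorem primeFreeOfWitnessAtEta_holds : Summit.Parity.GeneralizedHardyLittlewood.Theses.FordMaynardNoSieveConst0164.PrimeFreeOfWitnessAtEta := by
  intro γ η hγ0 hγ1 hη0 hη1' hex B
  obtain ⟨f, hf, hf1, hf2⟩ := hex
  have hη1 : η ≤ 1 := hη1'.le
  set δ : ℝ := -1 - f 1 (fun _ => 1) with hδ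
  have hδ0 : 0 < δ := by rw [hδ]; linarith
  obtain ⟨F, hF⟩ := hf.bounded
  have hF0 : 0 ≤ F := (abs_nonneg _).trans (hF 0 fun i => i.elim0)
  set N : ℕ := maxBlock η with hN
  set Kmax : ℕ := ⌊1 / η⌋₊ with hKmax
  set Cm : ℕ → ℝ := fun m => (N : ℝ) ^ m * ((N * (2 ^ N) ^ N / η ^ N) ^ m * F) *
    ((2 : ℝ) ^ (m * N) * (2 * (1 + m) ^ (m * N - 1))) with hCm
  have hCm0 : ∀ m, 0 ≤ Cm m := fun m => by rw [hCm]; positivity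
  set C : ℝ := ∑ m ∈ Finset.range (Kmax + 1), Cm m with hC
  have hC0 : 0 ≤ C := Finset.sum_nonneg fun m _ => hCm0 m
  have hCle : ∀ m, m ≤ Kmax → Cm m ≤ C := fun m hm =>
    Finset.single_le_sum (fun m _ => hCm0 m) (Finset.mem_range.2 (Nat.lt_succ_of_le hm))
  set ε : ℝ := min 1 (δ / (16 * (C + 1))) with hε
  have hε0 : 0 < ε := by rw [hε]; positivity
  have hε1 : ε ≤ 1 := min_le_left _ _
  have hεδ : 4 * ε * (C + 1) ≤ δ / 4 := by
    have : ε ≤ δ / (16 * (C + 1)) := min_le_right _ _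
    rw [le_div_iff₀ (by positivity)] at this
    linarith
  have hθν : (0 : ℝ) + η < 1 := by linarith
  -- bad intervals: `[γ-ε, γ+ε]` (index 0) and the edge `[η, η+ε]` (index 1)
  set lo : Fin 2 → ℝ := fun l => if l = 0 then γ - ε else η with hlo
  set wd : Fin 2 → ℝ := fun l => if l = 0 then 2 * ε else ε with hwd
  have hwd0 : ∀ l, 0 ≤ wd l := fun l => by
    rw [hwd]; simp only []; split_ifs <;> linarith
  set h : VecFn := tweak γ η lo wd f with hh
  have hsupp_f : ∀ (k : ℕ) (ξ : Fin k → ℝ), f k ξ ≠ 0 → (∀ i, η ≤ ξ i) ∧ ∑ i, ξ i = 1 := hf.support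
  have hsym : h.IsSymmetric := isSymmetric_tweak hf.symm
  have hpl : ∀ k, IsPiecewiseLipschitz (h k) := isPiecewiseLipschitz_tweak hγ0 hγ1 hη0 hf.piecewiseLipschitz
  obtain ⟨Hb, -, hHb⟩ := exists_bound_tweak (lo := lo) (wd := wd) hγ0 hγ1 hη0 hf.piecewiseLipschitz
  have htypeI : TypeIIdentity γ h := typeIIdentity_tweak hγ0 hγ1 hη0 hη1 hf.symm hf.piecewiseLipschitz hsupp_f
  have hsupp : ∀ (k : ℕ) (v : Fin k → ℝ), h k v ≠ 0 → ∀ i, η ≤ v i := fun k v hv => (tweak_support hv).1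
  have hvan : ∀ k, Kmax < k → ∀ v, h k v = 0 := fun k hk v =>
    tweak_eq_zero_of_lt hη0 (Nat.lt_of_floor_lt hk) v
  have h0 : ∀ v, h 0 v = 0 := fun v => tweak_zero v
  have hbad_of : ∀ (k : ℕ) (v : Fin k → ℝ) (A : Finset (Fin k)) (l : Fin 2), A.Nonempty → A ≠ Finset.univ →
      lo l ≤ ∑ i ∈ A, v i → ∑ i ∈ A, v i ≤ lo l + wd l → h k v = 0 := fun k v A l hAne hAuniv h1 h2 =>
    tweak_eq_zero_of_badSubsum ⟨A, hAne, hAuniv, l, h1, h2⟩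
  have hγv : ∀ (k : ℕ) (v : Fin k → ℝ) (A : Finset (Fin k)), A.Nonempty → A ≠ Finset.univ →
      γ - ε ≤ ∑ i ∈ A, v i → ∑ i ∈ A, v i ≤ γ + ε → h k v = 0 := by
    intro k v A hAne hAuniv h1 h2
    refine hbad_of k v A 0 hAne hAuniv ?_ ?_
    · show (if (0 : Fin 2) = 0 then γ - ε else η) ≤ _; rw [if_pos rfl]; exact h1
    · show _ ≤ (if (0 : Fin 2) = 0 then γ - ε else η) + (if (0 : Fin 2) = 0 then 2 * ε else ε)
      rw [if_pos rfl, if_pos rfl]; linarith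
  -- Type-II vanishing with `θ = 0`, `ν = η`: a proper subsum `≤ η + ε` of a support vector is a bad subsum
  have hθv : ∀ (k : ℕ) (v : Fin k → ℝ) (A : Finset (Fin k)), A.Nonempty → A ≠ Finset.univ →
      (0 : ℝ) - ε ≤ ∑ i ∈ A, v i → ∑ i ∈ A, v i ≤ 0 + η + ε → h k v = 0 := by
    intro k v A hAne hAuniv _ h2
    by_contra hv
    have hge : ∀ i, η ≤ v i := (tweak_support hv).1
    have h10 : (1 : Fin 2) ≠ 0 := by decide
    obtain ⟨t, ht⟩ := hAne
    have hAsum : η ≤ ∑ i ∈ A, v i :=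
      (hge t).trans (Finset.single_le_sum (fun i _ => hη0.le.trans (hge i)) ht)
    refine hv (hbad_of k v A 1 ⟨t, ht⟩ hAuniv ?_ ?_)
    · show (if (1 : Fin 2) = 0 then γ - ε else η) ≤ _; rw [if_neg h10]; exact hAsum
    · show _ ≤ (if (1 : Fin 2) = 0 then γ - ε else η) + (if (1 : Fin 2) = 0 then 2 * ε else ε)
      rw [if_neg h10, if_neg h10]; linarith
  -- closeness to `f` at good vectors
  have hsumwd : ∑ l, wd l = 3 * ε := by
    rw [hwd, Fin.sum_univ_two]; simp; ring
  have hCbound : C * (3 * ε) ≤ δ / 2 := by nlinarith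
  have hclose : ∀ (m : ℕ) (ξ : Fin m → ℝ), m ≤ Kmax → (∀ i, η ≤ ξ i) → ∑ i, ξ i = 1 →
      ¬ BadSubsum lo wd m ξ → |h m ξ - f m ξ| ≤ δ / 2 := by
    intro m ξ hm hξ hsum hgood
    have hb := abs_tweak_sub_le (lo := lo) (wd := wd) hf hη0 hη1 hγ1 hF hwd0 hξ hsum hgood
    rw [hsumwd] at hb
    calc |h m ξ - f m ξ| ≤ Cm m * (3 * ε) := by
          refine hb.trans (le_of_eq ?_); rw [hCm, hN]; ring
      _ ≤ C * (3 * ε) := mul_le_mul_of_nonneg_right (hCle m hm) (by linarith)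
      _ ≤ δ / 2 := hCbound
  have hK1 : 1 ≤ Kmax := by
    rw [hKmax]; exact Nat.le_floor (by rw [Nat.cast_one, le_div_iff₀ hη0]; linarith)
  have hgood1 : ¬ BadSubsum lo wd 1 (fun _ : Fin 1 => (1 : ℝ)) := by
    rintro ⟨A, hAne, hAuniv, -⟩
    apply hAuniv
    obtain ⟨t, ht⟩ := hAne
    ext s
    simp only [Finset.mem_univ, iff_true]
    rwa [Subsingleton.elim s t]
  have hz : h 1 (fun _ => 1) < -1 := by
    have := hclose 1 (fun _ => 1) hK1 (fun _ => hη1) (by simp) hgood1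
    rw [abs_le] at this
    linarith [this.2]
  have hlow : ∀ k, 2 ≤ k → ∀ v, h 1 (fun _ => 1) ≤ h k v := by
    intro k hk v
    by_cases hv : h k v = 0
    · rw [hv]; linarith
    · have hkK : k ≤ Kmax := by
        by_contra hlt; exact hv (hvan k (not_le.1 hlt) v)
      obtain ⟨hge, hsum⟩ := tweak_support hv
      have hgood : ¬ BadSubsum lo wd k v := fun hb => hv (tweak_eq_zero_of_badSubsum hb)
      have h1 := hclose k v hkK hge hsum hgood
      have h2 := hclose 1 (fun _ => 1) hK1 (fun _ => hη1) (by simp) hgood1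
      rw [abs_le] at h1 h2
      have := hf2 k hk v
      linarith [h1.1, h2.2]
  exact primeFreeAdmissible_of_vecFn hsym hη0 hη1 hγ0 hγ1 le_rfl hη0.le hθν hε0 hε1 hsupp hHb hpl
    htypeI hvan h0 hγv hθv hz hlow B

end Summit.Parity.GeneralizedHardyLittlewood.Theses.FordMaynardNoSieveConst0164
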